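import Summits.QuantumFields.YangMills.Theorems.ColdStartUniversalityLatticeLangevinBakryEmeryHessian
import HarnessLib

/-!
# Route `ColdStartUniversality` (fixed-cut-off package, Bakry–Émery side): the FIRST VARIATION of the Wilson plaquette sum is
# `O(√#𝒫 · ‖X‖)` — `|d/dt|₀ Σ_p Re tr hol_p(e^(tX)Q)| ≤ t(d−1)Σ_e‖X_e‖² + 2N#𝒫/t` for every `t > 0` (any `d`, `L`, `N`)

Helper file (seat `ym-line-csu-p1`, g27; `--supports stmt-QuantumFields-24809`).  Lattice bookkeeping for the carré du champ of the
plaquette (action) density `P̄ = (#𝒫)⁻¹ Σ_p Re tr U_p` (the input "`Γ(f) ≤ s`" of the volume-uniform concentration inequality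
`wilson_concentration_uniform`, `…BakryEmeryConcentration`, g26; consumed by `…PlaquetteCarre`):
* §1 `abs_re_trace_mul_right_le` / `_left_le` — AM–GM trace bound `|Re tr(X W)| ≤ (t‖X‖² + N/t)/2` for a co-isometry `W`, every `t > 0`
  (from the venture's square `re_trace_mul_mul_le`);
* §2 `abs_plaqReDeriv_zero_le` — the first variation of ONE plaquette term along `e^(tX)Q` at `t = 0` is at most
  `(t Σ_(e ∈ p) ‖X_e‖² + 4N/t)/2` (four first-order words, each `Re tr(±X_e · unitary)`);
* §3 `sum_plaquette_linkSq` — every link lies in `2(d−1)` plaquettes: `Σ_p Σ_(e∈p) ‖X_e‖² = 2(d−1) Σ_e ‖X_e‖²` (torus translations,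
  `Σ_b ([a<b] + [b<a]) = d − 1`);
* §4 ★ `abs_firstVariation_le` — `|Σ_p plaqReDeriv(Q,X,p,0)| ≤ t(d−1)·Σ_e‖X_e‖² + 2N·#𝒫/t` for unitary links and every `t > 0`
  (`Σ_p plaqReDeriv(·,0) = d/dt|₀ wilsonRe(e^(tX)Q)` for skew `X` by the venture's `hasDerivAt_wilsonRe_perturb`); optimising `t`:
  `≤ 2√(2(d−1)N#𝒫)·‖X‖` — the CLT scale.
(Shen–Zhu–Zhu, CMP 400 (2023), §3 Lemma 3.1 is the gradient formula; the bound is folklore bookkeeping, the first-order analogue of the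
venture's `abs_hessianForm_le_four_d`.)  THEOREMS ONLY, no definition, no sorry.  HONEST FRAMING: fixed-cut-off plumbing for a RECORD rung;
nothing K-uniform, no crux, rung or summit statement is proved, and the Yang–Mills mass gap is NOT proved.
-/

set_option autoImplicit false

noncomputable section

namespace Summit.QuantumFields.YangMills.Theorems.ColdStartUniversality

open MeasureTheory Matrix Complex Finset
open scoped ComplexConjugate BigOperators Matrix
open Literature.MathematicalPhysics.QuantumFieldTheory
open Literature.MathematicalPhysics.QuantumLattice (fundamentalRep fundamentalLatticeRep continuous_fundamentalRep fundamentalRep_apply)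
open Summit.Ventures.YMGap.HessianSharp (perturb wilsonRe plaqRe plaqReDeriv hessianForm tangentNormSq frobSq reTrWord
  hasDerivAt_wilsonRe_perturb reTrWord_zero re_trace_mul_mul_le frobSq_neg frobSq_nonneg mul_conjTranspose_self_of_mem
  conjTranspose_mem_unitaryGroup sum_shift)

/-! ## §1. AM–GM trace bounds against a co-isometry -/

section General

variable {n : Type*} [Fintype n] [DecidableEq n] {d L : ℕ}

omit [DecidableEq n] in
/-- `‖c X‖² = c² ‖X‖²` for a real scalar written as a complex one. [folklore] -/
theorem frobSq_real_smul (c : ℝ) (X : Matrix n n ℂ) : frobSq ((c : ℂ) • X) = c ^ 2 * frobSq X := by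
  unfold frobSq
  rw [Matrix.conjTranspose_smul, Matrix.smul_mul, Matrix.mul_smul, Matrix.trace_smul, Matrix.trace_smul]
  simp only [RCLike.star_def, Complex.conj_ofReal, smul_eq_mul]
  rw [← mul_assoc, ← Complex.ofReal_mul, Complex.re_ofReal_mul, sq]

/-- `‖1‖² = N`. [folklore] -/
theorem frobSq_one : frobSq (1 : Matrix n n ℂ) = Fintype.card n := by
  unfold frobSq
  rw [Matrix.conjTranspose_one, Matrix.mul_one, Matrix.trace_one]
  simp

/-- **AM–GM trace bound, right co-isometry**: `|Re tr(X W)| ≤ (t‖X‖² + N/t)/2` for `W Wᴴ = 1` and every `t > 0`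
(`Re tr(X W) = Re tr((√t X)(1/√t)W)` and the venture's square `re_trace_mul_mul_le`). [folklore] -/
theorem abs_re_trace_mul_right_le (X W : Matrix n n ℂ) (hW : W * Wᴴ = 1) {t : ℝ} (ht : 0 < t) :
    |(X * W).trace.re| ≤ (t * frobSq X + Fintype.card n / t) / 2 := by
  have key : ∀ Y : Matrix n n ℂ, (Y * W).trace.re ≤ (t * frobSq Y + Fintype.card n / t) / 2 := by
    intro Y
    set s : ℝ := Real.sqrt t with hs
    have hs0 : 0 < s := Real.sqrt_pos.2 ht
    have hss : s * s = t := Real.mul_self_sqrt ht.le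
    have hsne : (s : ℂ) ≠ 0 := by exact_mod_cast hs0.ne'
    have hprod : ((s : ℂ) • Y) * (((s⁻¹ : ℝ) : ℂ) • (1 : Matrix n n ℂ)) * W = Y * W := by
      rw [Matrix.smul_mul, Matrix.mul_smul, Matrix.mul_one, smul_smul, Complex.ofReal_inv, mul_inv_cancel₀ hsne, one_smul]
    have h := re_trace_mul_mul_le ((s : ℂ) • Y) (((s⁻¹ : ℝ) : ℂ) • (1 : Matrix n n ℂ)) W hW
    rw [hprod, frobSq_real_smul, frobSq_real_smul, frobSq_one] at h
    have e1 : s ^ 2 = t := by rw [sq, hss]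
    have e2 : s⁻¹ ^ 2 * (Fintype.card n : ℝ) = Fintype.card n / t := by rw [inv_pow, e1]; ring
    rw [e1, e2] at h
    exact h
  rw [abs_le]
  refine ⟨?_, key X⟩
  have h := key (-X)
  rw [Matrix.neg_mul, Matrix.trace_neg, Complex.neg_re, frobSq_neg] at h
  linarith

/-- **AM–GM trace bound, left co-isometry**: `|Re tr(W X)| ≤ (t‖X‖² + N/t)/2` for `W Wᴴ = 1`, `t > 0`. [folklore] -/
theorem abs_re_trace_mul_left_le (W X : Matrix n n ℂ) (hW : W * Wᴴ = 1) {t : ℝ} (ht : 0 < t) :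
    |(W * X).trace.re| ≤ (t * frobSq X + Fintype.card n / t) / 2 := by
  rw [Matrix.trace_mul_comm]
  exact abs_re_trace_mul_right_le X W hW ht

/-! ## §2. The first variation of one plaquette term -/

/-- **First-variation bound for one plaquette.**  For unitary links `Q`, any directions `X` and every `t > 0`, the first variation
`plaqReDeriv Q X x i j 0 = Σ_(k=1..4) Re tr(word with ±X_(e_k) inserted)` of `Re tr(Q₁Q₂Q₃ᴴQ₄ᴴ)` along `e^(tX)Q` satisfies
`|plaqReDeriv Q X x i j 0| ≤ (t·(‖X_(x,i)‖² + ‖X_(x+i,j)‖² + ‖X_(x+j,i)‖² + ‖X_(x,j)‖²) + 4N/t)/2`. [folklore] -/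
theorem abs_plaqReDeriv_zero_le (Q X : GaugeConfig d L (Matrix n n ℂ)) (hQ : ∀ e, Q e ∈ Matrix.unitaryGroup n ℂ)
    (x : Site d L) (i j : Fin d) {t : ℝ} (ht : 0 < t) :
    |plaqReDeriv Q X x i j 0| ≤
      (t * (frobSq (X (x, i)) + frobSq (X (x.shift i, j)) + frobSq (X (x.shift j, i)) + frobSq (X (x, j))) +
        4 * Fintype.card n / t) / 2 := by
  have hQ1 : Q (x, i) ∈ Matrix.unitaryGroup n ℂ := hQ _
  have hQ2 : Q (x.shift i, j) ∈ Matrix.unitaryGroup n ℂ := hQ _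
  have hQ3 : (Q (x.shift j, i))ᴴ ∈ Matrix.unitaryGroup n ℂ := conjTranspose_mem_unitaryGroup (hQ _)
  have hQ4 : (Q (x, j))ᴴ ∈ Matrix.unitaryGroup n ℂ := conjTranspose_mem_unitaryGroup (hQ _)
  -- the three unitary words
  have hW1 : Q (x, i) * (Q (x.shift i, j) * ((Q (x.shift j, i))ᴴ * (Q (x, j))ᴴ)) ∈ Matrix.unitaryGroup n ℂ :=
    mul_mem hQ1 (mul_mem hQ2 (mul_mem hQ3 hQ4))
  have hW2 : Q (x.shift i, j) * ((Q (x.shift j, i))ᴴ * ((Q (x, j))ᴴ * Q (x, i))) ∈ Matrix.unitaryGroup n ℂ :=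
    mul_mem hQ2 (mul_mem hQ3 (mul_mem hQ4 hQ1))
  have hW3 : (Q (x, j))ᴴ * (Q (x, i) * (Q (x.shift i, j) * (Q (x.shift j, i))ᴴ)) ∈ Matrix.unitaryGroup n ℂ :=
    mul_mem hQ4 (mul_mem hQ1 (mul_mem hQ2 hQ3))
  -- the four words at `t = 0`
  have e1 : (1 * X (x, i) * Q (x, i) * (Q (x.shift i, j) * (Q (x.shift j, i))ᴴ) * (Q (x, j))ᴴ * 1) =
      X (x, i) * (Q (x, i) * (Q (x.shift i, j) * ((Q (x.shift j, i))ᴴ * (Q (x, j))ᴴ))) := by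
    simp only [Matrix.one_mul, Matrix.mul_one, Matrix.mul_assoc]
  have e2 : (1 * (Q (x, i) * X (x.shift i, j)) * (Q (x.shift i, j) * (Q (x.shift j, i))ᴴ) * (Q (x, j))ᴴ * 1).trace =
      (X (x.shift i, j) * (Q (x.shift i, j) * ((Q (x.shift j, i))ᴴ * ((Q (x, j))ᴴ * Q (x, i))))).trace := by
    simp only [Matrix.one_mul, Matrix.mul_one, Matrix.mul_assoc]
    rw [Matrix.trace_mul_comm]
    simp only [Matrix.mul_assoc]
  have e3 : (1 * Q (x, i) * (Q (x.shift i, j) * (Q (x.shift j, i))ᴴ * -X (x.shift j, i)) * (Q (x, j))ᴴ * 1).trace =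
      (((Q (x, j))ᴴ * (Q (x, i) * (Q (x.shift i, j) * (Q (x.shift j, i))ᴴ))) * -X (x.shift j, i)).trace := by
    simp only [Matrix.one_mul, Matrix.mul_one]
    rw [Matrix.trace_mul_comm]
    simp only [Matrix.mul_assoc]
  have e4 : (1 * Q (x, i) * (Q (x.shift i, j) * (Q (x.shift j, i))ᴴ) * ((Q (x, j))ᴴ * -X (x, j)) * 1) =
      (Q (x, i) * (Q (x.shift i, j) * ((Q (x.shift j, i))ᴴ * (Q (x, j))ᴴ))) * -X (x, j) := by
    simp only [Matrix.one_mul, Matrix.mul_one, Matrix.mul_assoc]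
  -- the four bounds
  have b1 : |(1 * X (x, i) * Q (x, i) * (Q (x.shift i, j) * (Q (x.shift j, i))ᴴ) * (Q (x, j))ᴴ * 1).trace.re| ≤
      (t * frobSq (X (x, i)) + Fintype.card n / t) / 2 := by
    rw [e1]; exact abs_re_trace_mul_right_le _ _ (mul_conjTranspose_self_of_mem hW1) ht
  have b2 : |(1 * (Q (x, i) * X (x.shift i, j)) * (Q (x.shift i, j) * (Q (x.shift j, i))ᴴ) * (Q (x, j))ᴴ * 1).trace.re| ≤
      (t * frobSq (X (x.shift i, j)) + Fintype.card n / t) / 2 := by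
    rw [e2]; exact abs_re_trace_mul_right_le _ _ (mul_conjTranspose_self_of_mem hW2) ht
  have b3 : |(1 * Q (x, i) * (Q (x.shift i, j) * (Q (x.shift j, i))ᴴ * -X (x.shift j, i)) * (Q (x, j))ᴴ * 1).trace.re| ≤
      (t * frobSq (X (x.shift j, i)) + Fintype.card n / t) / 2 := by
    rw [e3, ← frobSq_neg (X (x.shift j, i))]; exact abs_re_trace_mul_left_le _ _ (mul_conjTranspose_self_of_mem hW3) ht
  have b4 : |(1 * Q (x, i) * (Q (x.shift i, j) * (Q (x.shift j, i))ᴴ) * ((Q (x, j))ᴴ * -X (x, j)) * 1).trace.re| ≤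
      (t * frobSq (X (x, j)) + Fintype.card n / t) / 2 := by
    rw [e4, ← frobSq_neg (X (x, j))]; exact abs_re_trace_mul_left_le _ _ (mul_conjTranspose_self_of_mem hW1) ht
  unfold plaqReDeriv
  rw [reTrWord_zero, reTrWord_zero, reTrWord_zero, reTrWord_zero]
  have hsplit : (t * (frobSq (X (x, i)) + frobSq (X (x.shift i, j)) + frobSq (X (x.shift j, i)) + frobSq (X (x, j))) +
        4 * Fintype.card n / t) / 2 =
      (t * frobSq (X (x, i)) + Fintype.card n / t) / 2 + (t * frobSq (X (x.shift i, j)) + Fintype.card n / t) / 2 +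
        (t * frobSq (X (x.shift j, i)) + Fintype.card n / t) / 2 + (t * frobSq (X (x, j)) + Fintype.card n / t) / 2 := by
    ring
  rw [hsplit]
  refine (abs_add_le _ _).trans (add_le_add ((abs_add_le _ _).trans (add_le_add ((abs_add_le _ _).trans (add_le_add b1 b2)) b3)) b4)

/-! ## §3. Every link lies in `2(d−1)` plaquettes -/

variable [NeZero L]

omit [DecidableEq n] in
/-- **Link–plaquette incidence count on the torus**: summing `‖X_e‖²` over the four links of every plaquette `(x; i<j)` gives
`2(d−1)·Σ_e ‖X_e‖²` (translation invariance of site sums; each direction pairs with `d−1` others). [folklore] -/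
theorem sum_plaquette_linkSq (X : GaugeConfig d L (Matrix n n ℂ)) :
    ∑ p : Plaquette d L, (frobSq (X (p.1, p.2.1.1)) + frobSq (X (p.1.shift p.2.1.1, p.2.1.2)) +
        frobSq (X (p.1.shift p.2.1.2, p.2.1.1)) + frobSq (X (p.1, p.2.1.2))) =
      2 * ((d : ℝ) - 1) * tangentNormSq X := by
  classical
  -- link sums per direction
  set T : Fin d → ℝ := fun a => ∑ x : Site d L, frobSq (X (x, a)) with hT
  have hTns : tangentNormSq X = ∑ a, T a := by
    unfold tangentNormSq
    rw [Fintype.sum_prod_type, Finset.sum_comm]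
  -- the site sum of one direction pair
  have hpair : ∀ a b : Fin d, ∑ x : Site d L, (frobSq (X (x, a)) + frobSq (X (x.shift a, b)) +
      frobSq (X (x.shift b, a)) + frobSq (X (x, b))) = 2 * (T a + T b) := by
    intro a b
    rw [Finset.sum_add_distrib, Finset.sum_add_distrib, Finset.sum_add_distrib,
      sum_shift a (fun v => frobSq (X (v, b))), sum_shift b (fun v => frobSq (X (v, a)))]
    simp only [hT]
    ring
  -- from the subtype `a < b` to a guarded double sum
  have hsub : ∑ p : Plaquette d L, (frobSq (X (p.1, p.2.1.1)) + frobSq (X (p.1.shift p.2.1.1, p.2.1.2)) +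
        frobSq (X (p.1.shift p.2.1.2, p.2.1.1)) + frobSq (X (p.1, p.2.1.2))) =
      ∑ a : Fin d, ∑ b : Fin d, (if a < b then 2 * (T a + T b) else 0) := by
    rw [Fintype.sum_prod_type, Finset.sum_comm]
    have h1 : ∑ s : {p : Fin d × Fin d // p.1 < p.2}, ∑ x : Site d L, (frobSq (X (x, s.1.1)) + frobSq (X (x.shift s.1.1, s.1.2)) +
        frobSq (X (x.shift s.1.2, s.1.1)) + frobSq (X (x, s.1.2))) =
        ∑ s : {p : Fin d × Fin d // p.1 < p.2}, 2 * (T s.1.1 + T s.1.2) :=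
      Finset.sum_congr rfl fun s _ => hpair s.1.1 s.1.2
    rw [h1, ← Finset.sum_subtype (Finset.univ.filter fun p : Fin d × Fin d => p.1 < p.2) (by simp)
      (fun p : Fin d × Fin d => 2 * (T p.1 + T p.2)), Finset.sum_filter, Fintype.sum_prod_type]
  rw [hsub]
  -- counting: `Σ_b ([a<b] + [b<a]) = d − 1`
  have hsplit : ∀ a b : Fin d, (if a < b then 2 * (T a + T b) else 0) = (if a < b then 2 * T a else 0) + (if a < b then 2 * T b else 0) := by
    intro a b; split_ifs <;> ring
  simp_rw [hsplit, Finset.sum_add_distrib]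
  have hswap : ∑ a : Fin d, ∑ b : Fin d, (if a < b then 2 * T b else 0) = ∑ a : Fin d, ∑ b : Fin d, (if b < a then 2 * T a else 0) :=
    Finset.sum_comm
  rw [hswap, ← Finset.sum_add_distrib]
  have hne : ∀ a : Fin d, ∑ b : Fin d, (if a < b then 2 * T a else 0) + ∑ b : Fin d, (if b < a then 2 * T a else 0) =
      ∑ b : Fin d, (if b ≠ a then 2 * T a else 0) := by
    intro a
    rw [← Finset.sum_add_distrib]
    refine Finset.sum_congr rfl fun b _ => ?_
    rcases lt_trichotomy a b with h | h | h
    · rw [if_pos h, if_neg (not_lt.mpr h.le), if_pos (ne_of_gt h), add_zero]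
    · subst h; rw [if_neg (lt_irrefl _), if_neg (not_not.mpr rfl), add_zero]
    · rw [if_neg (not_lt.mpr h.le), if_pos h, if_pos (ne_of_lt h), zero_add]
  have hcount : ∀ a : Fin d, ∑ b : Fin d, (if b ≠ a then 2 * T a else 0) = ((d : ℝ) - 1) * (2 * T a) := by
    intro a
    rw [← Finset.sum_filter, Finset.filter_ne', Finset.sum_const, Finset.card_erase_of_mem (Finset.mem_univ a),
      Finset.card_univ, Fintype.card_fin, nsmul_eq_mul, Nat.cast_pred (Fin.pos a)]
  simp_rw [hne, hcount]
  rw [hTns, Finset.mul_sum]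
  refine Finset.sum_congr rfl fun a _ => ?_
  ring

/-! ## §4. The first variation of the plaquette sum -/

/-- ★ **First-variation bound for the Wilson plaquette sum.**  On `(ℤ/L)^d` (any `d`, `L ≥ 1`, `n`), for unitary links `Q`, arbitrary
directions `X` and every `t > 0`:  `|Σ_p plaqReDeriv(Q,X,p,0)| ≤ t(d−1)·Σ_e‖X_e‖² + 2N·#𝒫/t`
(`= |d/dt|₀ Σ_p Re tr hol_p(e^(tX)Q)|` for skew `X`, `hasDerivAt_wilsonRe_perturb`); optimising `t`: `≤ 2√(2(d−1)N#𝒫)·‖X‖`.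
[cite: ShenZhuZhu2022, §3 Lemma 3.1] -/
theorem abs_firstVariation_le (Q X : GaugeConfig d L (Matrix n n ℂ)) (hQ : ∀ e, Q e ∈ Matrix.unitaryGroup n ℂ)
    {t : ℝ} (ht : 0 < t) :
    |∑ p : Plaquette d L, plaqReDeriv Q X p.1 p.2.1.1 p.2.1.2 0| ≤
      t * ((d : ℝ) - 1) * tangentNormSq X + 2 * Fintype.card n * Fintype.card (Plaquette d L) / t := by
  calc |∑ p : Plaquette d L, plaqReDeriv Q X p.1 p.2.1.1 p.2.1.2 0|
      ≤ ∑ p : Plaquette d L, |plaqReDeriv Q X p.1 p.2.1.1 p.2.1.2 0| := Finset.abs_sum_le_sum_abs _ _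
    _ ≤ ∑ p : Plaquette d L, (t * (frobSq (X (p.1, p.2.1.1)) + frobSq (X (p.1.shift p.2.1.1, p.2.1.2)) +
          frobSq (X (p.1.shift p.2.1.2, p.2.1.1)) + frobSq (X (p.1, p.2.1.2))) + 4 * Fintype.card n / t) / 2 :=
        Finset.sum_le_sum fun p _ => abs_plaqReDeriv_zero_le Q X hQ p.1 p.2.1.1 p.2.1.2 ht
    _ = t * ((d : ℝ) - 1) * tangentNormSq X + 2 * Fintype.card n * Fintype.card (Plaquette d L) / t := by
        rw [← Finset.sum_div, Finset.sum_add_distrib, ← Finset.mul_sum, sum_plaquette_linkSq, Finset.sum_const,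
          Finset.card_univ, nsmul_eq_mul]
        ring

end General

end Summit.QuantumFields.YangMills.Theorems.ColdStartUniversality
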